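import Summits.QuantumFields.YangMills.Theorems.SqueezedSkewnessMirrorDescentPrep
import Summits.QuantumFields.YangMills.Theorems.SqueezedSkewnessCeilingOfPairCollar
import HarnessLib

/-!
# Route `SqueezedSkewness`, LINE μ «slab response» in the PAIR currency (crux `BalabanLadder.NT`, stmt-QuantumFields-19353):
# torus-side floor transfer and ceiling at one coupling from a POINTWISE pair bound

`…MirrorDescentModulus` / `…MirrorDescentPrep` re-read with the `n`-point collar hypothesis replaced by what they use: a bound `B` on the
torus covariance of the action densities at sites `2R+4` apart in TIME (cyclically).  With LINE τ's `PairCollar6` (the `n = 2` case of the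
plane-resolved collar output, planner ym-idea-6 g14) the bound is `B = 36(C/R⁴)² = (6C/R⁴)²` (`abs_cov_dens_le₂`, via
`CeilingOfPairCollar.abs_cov_plane_le₂` ✓ and `cov_dens_eq_sum_cov_plane_univ` ✓):

* `torusSep_time_of_gap` — a reflected charge and a direct charge are `2R+4` apart in the TIME coordinate;
* `modulus_bound_of_pair`, `ceiling_bound_of_pair` — `|Q2(f₁,g₁) − Q2(f₂,g₂)| ≤ B·(S(f₁−f₂)S(g₁) + S(f₂)S(g₁−g₂))`, `|Q2(f,g)| ≤ S(f)S(g)·B`;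
* `floor_transfer_of_pair`, `ceiling_transfer_of_pair` — packaged with the ℓ¹-envelopes, as in `…MirrorDescentPrep`;
* `abs_cov_dens_le₂` — the dens pair bound from the `n = 2` plane collar bound.

Fleet lead `ym-spine-19353-p1` g23 (`--supports stmt-QuantumFields-19353`).  HONEST FRAMING: finite-torus bookkeeping at one coupling;
`PairCollar6` is NOT proved; no NT statement, crux, rung or mass gap follows. [folklore]
-/

set_option autoImplicit false

noncomputable section

open scoped SchwartzMap
open MeasureTheory Filter Topology
open Literature.MathematicalPhysics.QuantumFieldTheory Literature.MathematicalPhysics.QuantumLattice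
open Literature.Probability.LatticeModels
open Summit.QuantumFields.YangMills.Cruxes.OSLegsFromFemtoAndGap.DlrCollarTransfer
open Summit.QuantumFields.YangMills.Cruxes.NT.Reference
  (smul_siteToE_apply_zero sum_abs_lattice_le_sup_div tsupport_thetaTest_subset_closedBall_zero)
open Summit.QuantumFields.YangMills.Theorems.MirrorDescentModulus

namespace Summit.QuantumFields.YangMills.Theorems.MirrorDescentPairTorus

/-! ## §1 Geometry: time separation across the reflection plane -/

/-- **Time separation across the reflection plane.**  On the torus of side `2L+1` at spacing `s > 0`: lattice points `x`, `y` with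
`s·x₀ ≤ −δ`, `δ ≤ s·y₀`, both time coordinates of size `≤ σ` in physical units, `2σ ≤ sL` and `(R+2)s ≤ δ` are `2R+4` apart in the
time coordinate, cyclically. [folklore] -/
theorem torusSep_time_of_gap {s δ σ : ℝ} (hs : 0 < s) {L R : ℕ} (hσL : 2 * σ ≤ s * L) (hRδ : ((R : ℝ) + 2) * s ≤ δ)
    {x y : Fin 4 → ℤ} (hx0 : s * (x 0 : ℝ) ≤ -δ) (hy0 : δ ≤ s * (y 0 : ℝ)) (hax : |s * (x 0 : ℝ)| ≤ σ)
    (hay : |s * (y 0 : ℝ)| ≤ σ) :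
    (2 * (R : ℤ) + 4) ≤ |((((x 0 - y 0 : ℤ) : ZMod (2 * L + 1))).valMinAbs : ℤ)| := by
  have habs : |x 0 - y 0| ≤ (L : ℤ) := by
    have h1 : s * |((x 0 - y 0 : ℤ) : ℝ)| ≤ s * L := by
      push_cast
      rw [← abs_of_pos hs, ← abs_mul, mul_sub, abs_of_pos hs]
      calc |s * (x 0 : ℝ) - s * (y 0 : ℝ)| ≤ |s * (x 0 : ℝ)| + |s * (y 0 : ℝ)| := abs_sub _ _
        _ ≤ σ + σ := add_le_add hax hay
        _ ≤ s * L := by linarith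
    exact_mod_cast le_of_mul_le_mul_left h1 hs
  rw [Summit.QuantumFields.YangMills.Theorems.OSLegsFromFemtoAndGap.valMinAbs_intCast_of_abs_le habs]
  have hdiff : ((2 * (R : ℤ) + 4 : ℤ) : ℝ) * s ≤ s * (((y 0 - x 0 : ℤ)) : ℝ) := by
    push_cast
    nlinarith
  have h2 : ((2 * (R : ℤ) + 4 : ℤ) : ℝ) ≤ (((y 0 - x 0 : ℤ)) : ℝ) := by
    rw [mul_comm] at hdiff
    exact le_of_mul_le_mul_left hdiff hs
  have h3 : (2 * (R : ℤ) + 4) ≤ y 0 - x 0 := by exact_mod_cast h2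
  rw [abs_sub_comm]
  exact h3.trans (le_abs_self _)

/-! ## §2 Smeared bounds from a pointwise pair bound in the time coordinate -/

section Smeared

variable (G : Type) [Group G] [TopologicalSpace G] [IsTopologicalGroup G] [CompactSpace G]
  [MeasurableSpace G] [BorelSpace G] (r : LatticeRep G)

/-- **Modulus of continuity of the mirror two-point function from a pair bound.**  If the torus covariance of the action densities is
`≤ B` in absolute value at every pair of sites `2R+4` apart in time, `f₁, f₂` are charged only below time `−δ` and `g₁, g₂` only above
time `δ`, all four supported in the ball of radius `σ`, `2σ ≤ sL`, `(R+2)s ≤ δ`, then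
`|Q2(f₁, g₁) − Q2(f₂, g₂)| ≤ B·(S(f₁−f₂)·S(g₁) + S(f₂)·S(g₁−g₂))`. [folklore] -/
theorem modulus_bound_of_pair (β : ℝ) (L : ℕ) {B : ℝ} {R : ℕ}
    (HB : ∀ x y : Fin 4 → ℤ, (2 * (R : ℤ) + 4) ≤ |((((x 0 - y 0 : ℤ) : ZMod (2 * L + 1))).valMinAbs : ℤ)| →
      |torusE G r β L (fun U => dens G r x U * dens G r y U) - torusE G r β L (dens G r x) * torusE G r β L (dens G r y)| ≤ B)
    {s δ σ : ℝ} (hs : 0 < s) (hσL : 2 * σ ≤ s * L) (hRδ : ((R : ℝ) + 2) * s ≤ δ)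
    (f₁ f₂ g₁ g₂ : 𝓢(EuclideanSpace ℝ (Fin 4), ℝ))
    (hf₁ : ∀ p : EuclideanSpace ℝ (Fin 4), f₁ p ≠ 0 → p 0 ≤ -δ) (hf₂ : ∀ p : EuclideanSpace ℝ (Fin 4), f₂ p ≠ 0 → p 0 ≤ -δ)
    (hg₁ : ∀ p : EuclideanSpace ℝ (Fin 4), g₁ p ≠ 0 → δ ≤ p 0) (hg₂ : ∀ p : EuclideanSpace ℝ (Fin 4), g₂ p ≠ 0 → δ ≤ p 0)
    (hf₁σ : tsupport (f₁ : EuclideanSpace ℝ (Fin 4) → ℝ) ⊆ Metric.closedBall 0 σ)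
    (hf₂σ : tsupport (f₂ : EuclideanSpace ℝ (Fin 4) → ℝ) ⊆ Metric.closedBall 0 σ)
    (hg₁σ : tsupport (g₁ : EuclideanSpace ℝ (Fin 4) → ℝ) ⊆ Metric.closedBall 0 σ)
    (hg₂σ : tsupport (g₂ : EuclideanSpace ℝ (Fin 4) → ℝ) ⊆ Metric.closedBall 0 σ) :
    |Q2 G r β L s f₁ g₁ - Q2 G r β L s f₂ g₂| ≤
      B * ((∑ x ∈ box 4 L, |f₁ (s • siteToE x) - f₂ (s • siteToE x)|) * (∑ y ∈ box 4 L, |g₁ (s • siteToE y)|) +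
        (∑ x ∈ box 4 L, |f₂ (s • siteToE x)|) * (∑ y ∈ box 4 L, |g₁ (s • siteToE y) - g₂ (s • siteToE y)|)) := by
  refine abs_Q2_sub_Q2_le G r β L s f₁ f₂ g₁ g₂ fun x _ y _ hx hy => ?_
  have hxd : s * (x 0 : ℝ) ≤ -δ ∧ |s * (x 0 : ℝ)| ≤ σ := by
    rcases hx with hx | hx
    · exact charge_below hf₁ hf₁σ hx
    · exact charge_below hf₂ hf₂σ hx
  have hyd : δ ≤ s * (y 0 : ℝ) ∧ |s * (y 0 : ℝ)| ≤ σ := by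
    rcases hy with hy | hy
    · exact charge_above hg₁ hg₁σ hy
    · exact charge_above hg₂ hg₂σ hy
  exact HB x y (torusSep_time_of_gap hs hσL hRδ hxd.1 hyd.1 hxd.2 hyd.2)

/-- **Ceiling of the mirror two-point function from a pair bound.** [folklore] -/
theorem ceiling_bound_of_pair (β : ℝ) (L : ℕ) {B : ℝ} {R : ℕ}
    (HB : ∀ x y : Fin 4 → ℤ, (2 * (R : ℤ) + 4) ≤ |((((x 0 - y 0 : ℤ) : ZMod (2 * L + 1))).valMinAbs : ℤ)| →
      |torusE G r β L (fun U => dens G r x U * dens G r y U) - torusE G r β L (dens G r x) * torusE G r β L (dens G r y)| ≤ B)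
    {s δ σ : ℝ} (hs : 0 < s) (hσL : 2 * σ ≤ s * L) (hRδ : ((R : ℝ) + 2) * s ≤ δ)
    (f g : 𝓢(EuclideanSpace ℝ (Fin 4), ℝ))
    (hf : ∀ p : EuclideanSpace ℝ (Fin 4), f p ≠ 0 → p 0 ≤ -δ) (hg : ∀ p : EuclideanSpace ℝ (Fin 4), g p ≠ 0 → δ ≤ p 0)
    (hfσ : tsupport (f : EuclideanSpace ℝ (Fin 4) → ℝ) ⊆ Metric.closedBall 0 σ)
    (hgσ : tsupport (g : EuclideanSpace ℝ (Fin 4) → ℝ) ⊆ Metric.closedBall 0 σ) :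
    |Q2 G r β L s f g| ≤
      (∑ x ∈ box 4 L, |f (s • siteToE x)|) * (∑ y ∈ box 4 L, |g (s • siteToE y)|) * B := by
  refine Summit.QuantumFields.YangMills.Cruxes.NT.CeilingPrice.abs_Q2_le_of_pointwise G r β L s f g fun x _ y _ hx hy => ?_
  obtain ⟨hx0, hxσ⟩ := charge_below hf hfσ hx
  obtain ⟨hy0, hyσ⟩ := charge_above hg hgσ hy
  exact HB x y (torusSep_time_of_gap hs hσL hRδ hx0 hy0 hxσ hyσ)

/-! ## §3 Packaged with the envelopes -/

/-- **Floor transfer to a small shift at one coupling, from a pair bound** (`…MirrorDescentPrep.floor_transfer` re-read):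
`|Q2(θu, u) − Q2(θv, v)| ≤ B·2·(4⁴K₁‖e‖/α⁴)·(M·9⁴/α⁴)` for `u = v(· + e)`, `‖e‖ ≤ 1`. [folklore] -/
theorem floor_transfer_of_pair (β : ℝ) (L : ℕ) {B : ℝ} {R : ℕ}
    (HB : ∀ x y : Fin 4 → ℤ, (2 * (R : ℤ) + 4) ≤ |((((x 0 - y 0 : ℤ) : ZMod (2 * L + 1))).valMinAbs : ℤ)| →
      |torusE G r β L (fun U => dens G r x U * dens G r y U) - torusE G r β L (dens G r x) * torusE G r β L (dens G r y)| ≤ B)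
    (hB0 : 0 ≤ B) {α δ M K₁ : ℝ} (hα : 0 < α) (hα1 : α ≤ 1) (hσL : 2 * (3 : ℝ) ≤ α * L) (hRδ : ((R : ℝ) + 2) * α ≤ δ)
    (v u : 𝓢(EuclideanSpace ℝ (Fin 4), ℝ)) (e : EuclideanSpace ℝ (Fin 4)) (he : ‖e‖ ≤ 1)
    (hu : ∀ y, u y = v (y + e))
    (gap_u : ∀ p : EuclideanSpace ℝ (Fin 4), u p ≠ 0 → δ ≤ p 0)
    (gap_v : ∀ p : EuclideanSpace ℝ (Fin 4), v p ≠ 0 → δ ≤ p 0)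
    (ball_u : tsupport (u : EuclideanSpace ℝ (Fin 4) → ℝ) ⊆ Metric.closedBall 0 3)
    (ball_v : tsupport (v : EuclideanSpace ℝ (Fin 4) → ℝ) ⊆ Metric.closedBall 0 3)
    (hM : ∀ y, |v y| ≤ M)
    (hK₁ : ∀ (z e' : EuclideanSpace ℝ (Fin 4)), ‖e'‖ ≤ 1 → |v (z + e') - v z| ≤ K₁ * ‖e'‖ * ((1 + ‖z‖) ^ 8)⁻¹) :
    |Q2 G r β L α (thetaTest 4 u) u - Q2 G r β L α (thetaTest 4 v) v| ≤
      B * (2 * ((4 ^ 4 * K₁ * ‖e‖ / α ^ 4) * (M * (2 * 3 + 3) ^ 4 / α ^ 4))) := by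
  have hM0 : 0 ≤ M := (abs_nonneg _).trans (hM 0)
  have hMu : ∀ y, |u y| ≤ M := fun y => by rw [hu]; exact hM _
  have hMθv : ∀ y, |thetaTest 4 v y| ≤ M := fun y => by rw [thetaTest_apply]; exact hM _
  have hmod := modulus_bound_of_pair G r β L HB hα hσL hRδ (thetaTest 4 u) (thetaTest 4 v) u v
    (theta_gap gap_u) (theta_gap gap_v) gap_u gap_v
    (tsupport_thetaTest_subset_closedBall_zero ball_u) (tsupport_thetaTest_subset_closedBall_zero ball_v) ball_u ball_v
  have Su : ∑ x ∈ box 4 L, |u (α • siteToE x)| ≤ M * (2 * 3 + 3) ^ 4 / α ^ 4 :=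
    sum_abs_lattice_le_sup_div hMu ball_u (by norm_num) hα hα1 _
  have Sθv : ∑ x ∈ box 4 L, |thetaTest 4 v (α • siteToE x)| ≤ M * (2 * 3 + 3) ^ 4 / α ^ 4 :=
    sum_abs_lattice_le_sup_div hMθv (tsupport_thetaTest_subset_closedBall_zero ball_v) (by norm_num) hα hα1 _
  have Duv : ∑ x ∈ box 4 L, |u (α • siteToE x) - v (α • siteToE x)| ≤ 4 ^ 4 * K₁ * ‖e‖ / α ^ 4 := by
    simp only [hu]
    exact sum_abs_sub_shift_le hK₁ L hα hα1 he
  have Dθuv : ∑ x ∈ box 4 L, |thetaTest 4 u (α • siteToE x) - thetaTest 4 v (α • siteToE x)| ≤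
      4 ^ 4 * K₁ * ‖e‖ / α ^ 4 := by
    simp only [thetaTest_apply, hu]
    exact sum_abs_sub_shift_theta_le hK₁ L hα hα1 he
  have hS0 : ∀ f : EuclideanSpace ℝ (Fin 4) → ℝ, 0 ≤ ∑ x ∈ box 4 L, |f (α • siteToE x)| :=
    fun f => Finset.sum_nonneg fun _ _ => abs_nonneg _
  have hA0 : 0 ≤ 4 ^ 4 * K₁ * ‖e‖ / α ^ 4 := (Finset.sum_nonneg fun _ _ => abs_nonneg _).trans Duv
  have hB0' : 0 ≤ M * (2 * 3 + 3) ^ 4 / α ^ 4 := by positivity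
  have h1 : (∑ x ∈ box 4 L, |thetaTest 4 u (α • siteToE x) - thetaTest 4 v (α • siteToE x)|) *
      (∑ y ∈ box 4 L, |u (α • siteToE y)|) ≤ (4 ^ 4 * K₁ * ‖e‖ / α ^ 4) * (M * (2 * 3 + 3) ^ 4 / α ^ 4) :=
    mul_le_mul Dθuv Su (hS0 _) hA0
  have h2 : (∑ x ∈ box 4 L, |thetaTest 4 v (α • siteToE x)|) *
      (∑ y ∈ box 4 L, |u (α • siteToE y) - v (α • siteToE y)|) ≤ (M * (2 * 3 + 3) ^ 4 / α ^ 4) * (4 ^ 4 * K₁ * ‖e‖ / α ^ 4) :=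
    mul_le_mul Sθv Duv (Finset.sum_nonneg fun _ _ => abs_nonneg _) hB0'
  refine hmod.trans (mul_le_mul_of_nonneg_left ?_ hB0)
  calc (∑ x ∈ box 4 L, |thetaTest 4 u (α • siteToE x) - thetaTest 4 v (α • siteToE x)|) *
          (∑ y ∈ box 4 L, |u (α • siteToE y)|) +
        (∑ x ∈ box 4 L, |thetaTest 4 v (α • siteToE x)|) *
          (∑ y ∈ box 4 L, |u (α • siteToE y) - v (α • siteToE y)|)
      ≤ (4 ^ 4 * K₁ * ‖e‖ / α ^ 4) * (M * (2 * 3 + 3) ^ 4 / α ^ 4) +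
          (M * (2 * 3 + 3) ^ 4 / α ^ 4) * (4 ^ 4 * K₁ * ‖e‖ / α ^ 4) := add_le_add h1 h2
    _ = 2 * ((4 ^ 4 * K₁ * ‖e‖ / α ^ 4) * (M * (2 * 3 + 3) ^ 4 / α ^ 4)) := by ring

/-- **Ceiling at one coupling from a pair bound** (`…MirrorDescentPrep.ceiling_transfer` re-read): `Q2(θf, f) ≤ (M·9⁴/α⁴)²·B`. [folklore] -/
theorem ceiling_transfer_of_pair (β : ℝ) (L : ℕ) {B : ℝ} {R : ℕ}
    (HB : ∀ x y : Fin 4 → ℤ, (2 * (R : ℤ) + 4) ≤ |((((x 0 - y 0 : ℤ) : ZMod (2 * L + 1))).valMinAbs : ℤ)| →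
      |torusE G r β L (fun U => dens G r x U * dens G r y U) - torusE G r β L (dens G r x) * torusE G r β L (dens G r y)| ≤ B)
    (hB0 : 0 ≤ B) {α δ M : ℝ} (hα : 0 < α) (hα1 : α ≤ 1) (hσL : 2 * (3 : ℝ) ≤ α * L) (hRδ : ((R : ℝ) + 2) * α ≤ δ)
    (f : 𝓢(EuclideanSpace ℝ (Fin 4), ℝ))
    (gap_f : ∀ p : EuclideanSpace ℝ (Fin 4), f p ≠ 0 → δ ≤ p 0)
    (ball_f : tsupport (f : EuclideanSpace ℝ (Fin 4) → ℝ) ⊆ Metric.closedBall 0 3) (hM : ∀ y, |f y| ≤ M) :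
    Q2 G r β L α (thetaTest 4 f) f ≤ (M * (2 * 3 + 3) ^ 4 / α ^ 4) * (M * (2 * 3 + 3) ^ 4 / α ^ 4) * B := by
  have hM0 : 0 ≤ M := (abs_nonneg _).trans (hM 0)
  have hMθ : ∀ y, |thetaTest 4 f y| ≤ M := fun y => by rw [thetaTest_apply]; exact hM _
  have h := ceiling_bound_of_pair G r β L HB hα hσL hRδ (thetaTest 4 f) f (theta_gap gap_f) gap_f
    (tsupport_thetaTest_subset_closedBall_zero ball_f) ball_f
  have Sf : ∑ x ∈ box 4 L, |f (α • siteToE x)| ≤ M * (2 * 3 + 3) ^ 4 / α ^ 4 :=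
    sum_abs_lattice_le_sup_div hM ball_f (by norm_num) hα hα1 _
  have Sθ : ∑ x ∈ box 4 L, |thetaTest 4 f (α • siteToE x)| ≤ M * (2 * 3 + 3) ^ 4 / α ^ 4 :=
    sum_abs_lattice_le_sup_div hMθ (tsupport_thetaTest_subset_closedBall_zero ball_f) (by norm_num) hα hα1 _
  refine (le_abs_self _).trans (h.trans ?_)
  exact mul_le_mul_of_nonneg_right
    (mul_le_mul Sθ Sf (Finset.sum_nonneg fun _ _ => abs_nonneg _) (by positivity)) hB0

/-! ## §4 The dens pair bound from the `n = 2` plane collar bound -/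

/-- **Two action densities separated in time have small torus covariance, from the PAIR collar output**: `|Cov_T(dens X, dens Y)| ≤
(6C/R⁴)²` once the times of `X`, `Y` are `≥ 2R + 4` apart cyclically (`6 × 6` plane pairs, each bounded by
`CeilingOfPairCollar.abs_cov_plane_le₂` ✓ under the `n = 2` plane-resolved collar bound). [folklore] -/
theorem abs_cov_dens_le₂ (β : ℝ) (L : ℕ) {C : ℝ} {R : ℕ}
    (H : ∀ (q : Fin 2 → Fin 4 × Fin 4) (x : Fin 2 → (Fin 4 → ℤ)), (∀ i, (q i).1 < (q i).2) →
      (∀ i j : Fin 2, i ≠ j → ∃ k : Fin 4,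
        (2 * (R : ℤ) + 4) ≤ |((((x i k - x j k : ℤ) : ZMod (2 * L + 1))).valMinAbs : ℤ)|) →
      |torusE G r β L (fun U => ∏ i, (plane G r (q i) (x i) U - torusE G r β L (plane G r (q i) (x i))))| ≤
        (C / (R : ℝ) ^ 4) ^ 2)
    (X Y : Fin 4 → ℤ) (hsep : (2 * (R : ℤ) + 4) ≤ |((((X 0 - Y 0 : ℤ) : ZMod (2 * L + 1))).valMinAbs : ℤ)|) :
    |torusE G r β L (fun V => dens G r X V * dens G r Y V) - torusE G r β L (dens G r X) * torusE G r β L (dens G r Y)| ≤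
      (6 * C / (R : ℝ) ^ 4) ^ 2 := by
  rw [Summit.QuantumFields.YangMills.Cruxes.UniversalDetectorPlaneTight.cov_dens_eq_sum_cov_plane_univ r β L X Y]
  refine (Finset.abs_sum_le_sum_abs _ _).trans ?_
  have h1 : ∀ p ∈ (Finset.univ : Finset {q : Fin 4 × Fin 4 // q.1 < q.2}),
      |∑ q : {q : Fin 4 × Fin 4 // q.1 < q.2},
        (torusE G r β L (fun V => plane G r p.1 X V * plane G r q.1 Y V) -
          torusE G r β L (plane G r p.1 X) * torusE G r β L (plane G r q.1 Y))| ≤ 6 * (C / (R : ℝ) ^ 4) ^ 2 := by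
    intro p _
    refine (Finset.abs_sum_le_sum_abs _ _).trans ?_
    have h2 : ∀ q ∈ (Finset.univ : Finset {q : Fin 4 × Fin 4 // q.1 < q.2}),
        |torusE G r β L (fun V => plane G r p.1 X V * plane G r q.1 Y V) -
          torusE G r β L (plane G r p.1 X) * torusE G r β L (plane G r q.1 Y)| ≤ (C / (R : ℝ) ^ 4) ^ 2 :=
      fun q _ => Summit.QuantumFields.YangMills.Theorems.CeilingOfPairCollar.abs_cov_plane_le₂ G r β L H p q X Y hsep
    refine (Finset.sum_le_sum h2).trans ?_
    rw [Finset.sum_const, Finset.card_univ, show Fintype.card {q : Fin 4 × Fin 4 // q.1 < q.2} = 6 by decide,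
      nsmul_eq_mul]
    norm_num
  refine (Finset.sum_le_sum h1).trans ?_
  rw [Finset.sum_const, Finset.card_univ, show Fintype.card {q : Fin 4 × Fin 4 // q.1 < q.2} = 6 by decide,
    nsmul_eq_mul]
  norm_num
  exact le_of_eq (by ring)

end Smeared

end Summit.QuantumFields.YangMills.Theorems.MirrorDescentPairTorus

end
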